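import Summits.AtomisticToContinuum.Crystallization.Theorems.TwoCentreKissingKernelRobustTangencyBoundRK42CertE
import HarnessLib

/-!
# `RobustTangencyBound` — kernel certificates of configuration `RK42` (step (III) factory, partial level, part F)

Route `TwoCentreKissingKernel`, item `stmt-AtomisticToContinuum-12082`, blueprint (III) §8/§11.  Generated by `work/factory/hexgen.py`: the systems of this level are
the surviving prefixes of the previous level times `m ≤ 5` for the newly constrained vertex (`rk42Keys`); those still not
excluded form `rk42Bad` and are handled at the next level.
-/

namespace Summit.AtomisticToContinuum.Crystallization.Theorems

open Literature.Analysis.ValidatedNumerics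

/-- Kernel certificate of `rk42Claim 2 5`. -/
theorem rk42Claim_holds_2_5 : (rk42Claim 2 5).Holds :=
  RInfeasClaim.holds_of_check _ (.split 0 ((-1)/250) (.split 1 ((-1)/250) (.leaf (14, 5)) (.leaf (14, 5))) (.leaf (14, 5))) (by decide +kernel)

/-- **Configuration `RK42` is infeasible for the counts of `rk42Keys`** (minus `rk42Bad`). -/
theorem rk42Claim_holds (m1 : ℕ) (m2 : ℕ)
    (hkeys : ((m1, m2) : ℕ × ℕ) ∈ rk42Keys)
    (hgood : ((m1, m2) : ℕ × ℕ) ∉ rk42Bad) :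
    (rk42Claim m1 m2).Holds := by
  simp only [rk42Keys, List.mem_cons, List.mem_nil_iff, or_false, Prod.mk.injEq] at hkeys
  rcases hkeys with h | h | h | h | h | h | h | h | h | h | h | h
  · obtain ⟨rfl, rfl⟩ := h
    exact rk42Claim_holds_1_0
  · obtain ⟨rfl, rfl⟩ := h
    exact rk42Claim_holds_1_1
  · obtain ⟨rfl, rfl⟩ := h
    exact (hgood (by decide)).elim
  · obtain ⟨rfl, rfl⟩ := h
    exact rk42Claim_holds_1_3
  · obtain ⟨rfl, rfl⟩ := h
    exact rk42Claim_holds_1_4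
  · obtain ⟨rfl, rfl⟩ := h
    exact rk42Claim_holds_1_5
  · obtain ⟨rfl, rfl⟩ := h
    exact rk42Claim_holds_2_0
  · obtain ⟨rfl, rfl⟩ := h
    exact rk42Claim_holds_2_1
  · obtain ⟨rfl, rfl⟩ := h
    exact rk42Claim_holds_2_2
  · obtain ⟨rfl, rfl⟩ := h
    exact rk42Claim_holds_2_3
  · obtain ⟨rfl, rfl⟩ := h
    exact rk42Claim_holds_2_4
  · obtain ⟨rfl, rfl⟩ := h
    exact rk42Claim_holds_2_5

end Summit.AtomisticToContinuum.Crystallization.Theorems
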